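import Literature.NumberTheory.EllipticCurves.ZpExtensionShapiroShiftedLocalConditionsProofs
import Literature.NumberTheory.EllipticCurves.LambdaAdicSelmerDataTorsionPowReduce
import Literature.NumberTheory.GaloisCohomology.Howard2004.TowerReindex
import HarnessLib

/-!
# The pushforward `Hom` out of lit's SHIFTED, REINDEXED `Λ`-adic source: `f_red` along iterated reductions, the admissible
# index sequence, `cond_le` in the `shapiroTowerTriple` currency, and the LINK `H¹(f_{j+1,k}) (Φ′ z)_j = proj_k (control map z)`
# (theorems only)

Topic `NumberTheory/EllipticCurves` (sequel of `ZpExtensionShapiroShiftedLocalConditionsProofs` (G5a-1), `…ShapiroToEisensteinLevelMap`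
(C11), `LambdaAdicSelmerDataTorsionPowReduce` (C8 hook), lit's `ZpExtensionShapiroSetting` (A2) and Howard's `TowerReindex`).
Cell `pub/bsd-print-x9`, seat `bsd-line-x9-p2` g4, STUB A of the shared μ-crux: the remaining THEOREM inputs of the ONE
`CoeffTowerSetting.Hom.ofBaseChange` from `(W.shapiroSettingTame …).reindex s₀ d` into D1's `eisensteinDVRSettingLevelsTame`
with level maps `f k := shapiroToEisensteinLevelMap (idxSeq s₀ d k + 1) (k+1)`:
* §1 `f_red` on the shifted tower (Howard Rem. 1.2.4 / §1.6): `f_{i+1,k} ∘ red_i = f_{i+2,k}` (T1 of G4b-1), its iterate along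
  `redIter i d` (= the reduction of the reindexed source), and **`shapiroToEisensteinLevelMap_coeffAdicTower_succ_redIter_eq_red`**:
  `f_{i+1,k+1} (redIter i d x) = red′_k (f_{i+d+1,k+2} x)` (with T2);
* §2 **`exists_idxSeq_adm`**: an index sequence `σ = idxSeq s₀ d` with `d ≥ 1` such that EVERY Shapiro level `σ' ≥ σ(k) + 1` is
  admissible for the target level `k+1` (`k+1 ≤ σ'`, `(ω_{σ'}, p^{σ'}) ≤ (q_m, p^{k+1})`; Howard Lemma 2.2.7 / Washington §13.2);
* §3 for the curve: **`WeierstrassCurve.map_shapiroTowerTriple_cond_le_eisensteinSelmerStructure`** — G5a-1 read on lit's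
  `shapiroTowerTriple` and the `ContinuousRep.cohomologyMap` spelling of `Hom.cond_le`; and the LINK
  **`WeierstrassCurve.map_shapiroToEisensteinTwistLe_toShapiroSuccLimitH1_eq_proj_toEisensteinH1`**: `H¹(f_{j+1,k}) (Φ′ z)_j =
  proj_k (toEisensteinH1 z)` (C8's hook read on lit's `Φ′ = toShapiroSuccLimitH1`).
Theorems only; no named fact, no instance, no notation, no `sorry`.  BSD is not proved by any of this.

References: [Howard2004HeegnerKolyvagin] Rem. 1.2.4, §1.6, Lemma 2.2.7, proof of Thm. 2.2.10 (arXiv p. 7 L13–27, p. 12 L29–33, p0016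
L142–148, p0017 L78–81); [CastellaGrossiLeeSkinner2022] §3.4, Rem. 4.1.4; [Washington1997] §13.2; [SerreGaloisCohomology1997] I §2.2, II §6.1.
-/

noncomputable section

open scoped TensorProduct Topology Classical ContRepresentation
open Field CategoryTheory IsLocalRing IsDedekindDomain
open scoped NumberField

namespace Literature.NumberTheory.EllipticCurves.ZpExtension

open Literature.NumberTheory.GaloisRepresentations
open Literature.NumberTheory.GaloisCohomology.Howard2004

/-! ## §1 `f_red` on the shifted tower: the level maps against (iterated) reductions -/

section FRed

variable {K : Type} [Field K] {V : WeierstrassCurve K} {p : ℕ} [hp : Fact p.Prime] (κ : ZpExtension K p)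
  (t : ∀ k, (V.torsionGaloisModule ((p : ℤ) ^ (k + 1))).toContRepresentation →ⁱL
    (V.torsionGaloisModule ((p : ℤ) ^ k)).toContRepresentation)
  (ht : ∀ k (P : WeierstrassCurve.geomTorsion V ((p : ℤ) ^ (k + 1))), t k P = V.geomTorsionReduce p k P)
  (hts : ∀ k, Function.Surjective (t k)) {m : ℕ} (hm : 1 ≤ m)

include ht in
/-- **(T1) for the additive level maps on the shifted tower**: `f_{i+1,k} (red_i x) = f_{i+2,k} x`.
[cite: Howard2004HeegnerKolyvagin, Rem. 1.2.4 and §1.6 (arXiv p. 7 L13–27, p. 12 L29–33)] -/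
theorem shapiroToEisensteinLevelMap_coeffAdicTower_succ_red (i k : ℕ) (hσ : k ≤ i + 1) (hσ' : k ≤ i + 1 + 1)
    (hle : shapiroIdeal p (i + 1) ≤ Ideal.span {(PowerSeries.X ^ m + PowerSeries.C (p : ℤ_[p]) : IwasawaAlgebra p)} ⊔
      Ideal.span {PowerSeries.C ((p : ℤ_[p]) ^ k)})
    (hle' : shapiroIdeal p (i + 1 + 1) ≤ Ideal.span {(PowerSeries.X ^ m + PowerSeries.C (p : ℤ_[p]) : IwasawaAlgebra p)} ⊔
      Ideal.span {PowerSeries.C ((p : ℤ_[p]) ^ k)})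
    (x : CoeffLevel p (fun j ↦ shapiroIdeal p (j + 1))
      (fun j ↦ WeierstrassCurve.geomTorsion V ((p : ℤ) ^ (j + 1))) (i + 1)) :
    κ.shapiroToEisensteinLevelMap V hm (i + 1) k hσ hle ((κ.coeffAdicTower (fun j ↦ V.torsionGaloisModule ((p : ℤ) ^ (j + 1))) (fun j ↦ t (j + 1))
      (fun j ↦ shapiroIdeal p (j + 1)) (fun j ↦ shapiroIdeal_succ_le p (j + 1)) (fun j ↦ j + 1) (fun j ↦ omega_mem_shapiroIdeal p (j + 1))
      (fun j ↦ (j + 1) * p ^ (j + 1) + (j + 1)) (fun j ↦ maximalIdeal_pow_le_shapiroIdeal p (j + 1)) (fun j ↦ hts (j + 1))).red i x) =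
      κ.shapiroToEisensteinLevelMap V hm (i + 1 + 1) k hσ' hle' x :=
  κ.shapiroToEisensteinTwistLe_coeffLevelReduce t ht hm (i + 1) k hσ hσ' hle hle' x

include ht in
/-- **(T1) iterated: `f_{i+1,k} ∘ redIter_{i,d} = f_{i+d+1,k}`** — the level map of the reindexed source against its reduction
`(T.reindex s₀ d).red = T.redIter`. [cite: Howard2004HeegnerKolyvagin, §1.6 (arXiv p. 12, L29–33) and Rem. 1.2.4] -/
theorem shapiroToEisensteinLevelMap_coeffAdicTower_succ_redIter (i k : ℕ) (hσ : k ≤ i + 1)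
    (hle : shapiroIdeal p (i + 1) ≤ Ideal.span {(PowerSeries.X ^ m + PowerSeries.C (p : ℤ_[p]) : IwasawaAlgebra p)} ⊔
      Ideal.span {PowerSeries.C ((p : ℤ_[p]) ^ k)}) :
    ∀ (d : ℕ) (hσ' : k ≤ i + d + 1)
      (hle' : shapiroIdeal p (i + d + 1) ≤ Ideal.span {(PowerSeries.X ^ m + PowerSeries.C (p : ℤ_[p]) : IwasawaAlgebra p)} ⊔
      Ideal.span {PowerSeries.C ((p : ℤ_[p]) ^ k)})
      (x : CoeffLevel p (fun j ↦ shapiroIdeal p (j + 1))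
      (fun j ↦ WeierstrassCurve.geomTorsion V ((p : ℤ) ^ (j + 1))) (i + d)),
      κ.shapiroToEisensteinLevelMap V hm (i + 1) k hσ hle ((κ.coeffAdicTower (fun j ↦ V.torsionGaloisModule ((p : ℤ) ^ (j + 1))) (fun j ↦ t (j + 1))
      (fun j ↦ shapiroIdeal p (j + 1)) (fun j ↦ shapiroIdeal_succ_le p (j + 1)) (fun j ↦ j + 1) (fun j ↦ omega_mem_shapiroIdeal p (j + 1))
      (fun j ↦ (j + 1) * p ^ (j + 1) + (j + 1)) (fun j ↦ maximalIdeal_pow_le_shapiroIdeal p (j + 1)) (fun j ↦ hts (j + 1))).redIter i d x) =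
        κ.shapiroToEisensteinLevelMap V hm (i + d + 1) k hσ' hle' x := by
  intro d
  induction d with
  | zero => intro hσ' hle' x; rfl
  | succ d ih =>
    intro hσ' hle' x
    have hσ'' : k ≤ i + d + 1 := by omega
    have hle'' : shapiroIdeal p (i + d + 1) ≤ Ideal.span {(PowerSeries.X ^ m + PowerSeries.C (p : ℤ_[p]) : IwasawaAlgebra p)} ⊔
      Ideal.span {PowerSeries.C ((p : ℤ_[p]) ^ k)} :=
      (antitone_nat_of_succ_le (shapiroIdeal_succ_le p) (by omega : i + 1 ≤ i + d + 1)).trans hle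
    rw [AdicTower.redIter_succ, ih hσ'' hle'' ((κ.coeffAdicTower (fun j ↦ V.torsionGaloisModule ((p : ℤ) ^ (j + 1))) (fun j ↦ t (j + 1))
      (fun j ↦ shapiroIdeal p (j + 1)) (fun j ↦ shapiroIdeal_succ_le p (j + 1)) (fun j ↦ j + 1) (fun j ↦ omega_mem_shapiroIdeal p (j + 1))
      (fun j ↦ (j + 1) * p ^ (j + 1) + (j + 1)) (fun j ↦ maximalIdeal_pow_le_shapiroIdeal p (j + 1)) (fun j ↦ hts (j + 1))).red (i + d) x)]
    exact κ.shapiroToEisensteinLevelMap_coeffAdicTower_succ_red t ht hts hm (i + d) k hσ'' hσ' hle'' hle' x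

include ht in
/-- **`Hom.f_red` for the shifted, reindexed source** (consecutive target levels `k+1 ≤ k+2`, source tower levels `i ≤ i+d`):
`f_{i+1,k+1} (redIter_{i,d} x) = red′_k (f_{i+d+1,k+2} x)`, `red′` = D1's `eisensteinAdicTowerSucc.red`.
[cite: Howard2004HeegnerKolyvagin, Rem. 1.2.4 (arXiv p. 7, L13–27) and §1.6 (arXiv p. 12, L29–33)] -/
theorem shapiroToEisensteinLevelMap_coeffAdicTower_succ_redIter_eq_red (i d k : ℕ) (hσ : k + 1 ≤ i + 1)
    (hσ' : k + 2 ≤ i + d + 1)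
    (hle : shapiroIdeal p (i + 1) ≤ Ideal.span {(PowerSeries.X ^ m + PowerSeries.C (p : ℤ_[p]) : IwasawaAlgebra p)} ⊔
      Ideal.span {PowerSeries.C ((p : ℤ_[p]) ^ (k + 1))})
    (hle' : shapiroIdeal p (i + d + 1) ≤ Ideal.span {(PowerSeries.X ^ m + PowerSeries.C (p : ℤ_[p]) : IwasawaAlgebra p)} ⊔
      Ideal.span {PowerSeries.C ((p : ℤ_[p]) ^ (k + 2))})
    (x : CoeffLevel p (fun j ↦ shapiroIdeal p (j + 1))
      (fun j ↦ WeierstrassCurve.geomTorsion V ((p : ℤ) ^ (j + 1))) (i + d)) :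
    letI := IwasawaAlgebra.isLocalRing_quotient_X_pow_add_C p hm
    κ.shapiroToEisensteinLevelMap V hm (i + 1) (k + 1) hσ hle ((κ.coeffAdicTower (fun j ↦ V.torsionGaloisModule ((p : ℤ) ^ (j + 1))) (fun j ↦ t (j + 1))
      (fun j ↦ shapiroIdeal p (j + 1)) (fun j ↦ shapiroIdeal_succ_le p (j + 1)) (fun j ↦ j + 1) (fun j ↦ omega_mem_shapiroIdeal p (j + 1))
      (fun j ↦ (j + 1) * p ^ (j + 1) + (j + 1)) (fun j ↦ maximalIdeal_pow_le_shapiroIdeal p (j + 1)) (fun j ↦ hts (j + 1))).redIter i d x) =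
      (κ.eisensteinAdicTowerSucc (fun j ↦ V.torsionGaloisModule ((p : ℤ) ^ j)) t hm hts).red k
        (κ.shapiroToEisensteinLevelMap V hm (i + d + 1) (k + 2) hσ' hle' x) := by
  have hle₁ : shapiroIdeal p (i + d + 1) ≤ Ideal.span {(PowerSeries.X ^ m + PowerSeries.C (p : ℤ_[p]) : IwasawaAlgebra p)} ⊔
      Ideal.span {PowerSeries.C ((p : ℤ_[p]) ^ (k + 1))} :=
    (antitone_nat_of_succ_le (shapiroIdeal_succ_le p) (by omega : i + 1 ≤ i + d + 1)).trans hle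
  rw [κ.shapiroToEisensteinLevelMap_coeffAdicTower_succ_redIter t ht hts hm i (k + 1) hσ hle d (by omega) hle₁ x]
  exact (κ.eisensteinTwistReduce_shapiroToEisensteinTwistLe t ht hm (i + d + 1) (k + 1) hσ' (by omega) hle' hle₁ x).symm

end FRed

/-! ## §2 The admissible index sequence -/

/-- **An admissible cofinal index sequence**: `σ = idxSeq s₀ d` with all `d k ≥ 1` such that every Shapiro level
`σ' ≥ σ(k) + 1` satisfies `k + 1 ≤ σ'` and `(ω_{σ'}, p^{σ'}) ≤ (q_m, p^{k+1})` (so the level maps `f_{σ(k)+1, k+1}` of the reindexed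
source exist, and so do all the intermediate ones `f_red` needs). [cite: Howard2004HeegnerKolyvagin, Lemma 2.2.7 and §1.6 (arXiv p. 12, p0016)] [cite: Washington1997, §13.2 (Lemma 13.7)] -/
theorem exists_idxSeq_adm (p : ℕ) [Fact p.Prime] {m : ℕ} (hm : 1 ≤ m) :
    ∃ (s₀ : ℕ) (d : ℕ → ℕ), (∀ k, 1 ≤ d k) ∧ ∀ k σ, idxSeq s₀ d k + 1 ≤ σ → k + 1 ≤ σ ∧
      shapiroIdeal p σ ≤ Ideal.span {(PowerSeries.X ^ m + PowerSeries.C (p : ℤ_[p]) : IwasawaAlgebra p)} ⊔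
        Ideal.span {PowerSeries.C ((p : ℤ_[p]) ^ (k + 1))} := by
  choose T hT using fun k ↦ exists_forall_shapiroIdeal_le p hm (k + 1)
  have hidx : ∀ k, T k + k ≤ idxSeq (T 0 + 1) (fun k ↦ T (k + 1) + k + 2) k := by
    intro k
    cases k with
    | zero => rw [idxSeq_zero]; omega
    | succ k => rw [idxSeq_succ]; omega
  refine ⟨T 0 + 1, fun k ↦ T (k + 1) + k + 2, fun k ↦ by show 1 ≤ T (k + 1) + k + 2; omega,
    fun k σ hσ ↦ ⟨?_, hT k σ ?_⟩⟩
  · have := hidx k; omega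
  · have := hidx k; omega

end Literature.NumberTheory.EllipticCurves.ZpExtension

/-! ## §3 For the curve: `cond_le` in lit's `shapiroTowerTriple` currency, and the LINK on `Φ′` -/

namespace WeierstrassCurve

open Literature.NumberTheory.EllipticCurves Literature.NumberTheory.GaloisRepresentations
open Literature.NumberTheory.GaloisRepresentations.DiscreteGaloisModule
open Literature.NumberTheory.GaloisCohomology.Howard2004
open Literature.NumberTheory.EllipticCurves.ZpExtension

variable {K : Type} [Field K] [NumberField K] (W : WeierstrassCurve ℚ) [W.IsElliptic] {p : ℕ} [hp : Fact p.Prime]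
  (κ : ZpExtension K p)
  (S : Finset (HeightOneSpectrum (𝓞 K)))
  (hpS : ∀ v : HeightOneSpectrum (𝓞 K), ((p : ℕ) : 𝓞 K) ∈ v.asIdeal → v ∈ S)
  (hbad : ∀ v : HeightOneSpectrum (𝓞 K), v ∉ S → ((p : ℕ) : 𝓞 K) ∉ v.asIdeal → (W.baseChange K).HasGoodReductionAt v)
  (L : Set (HeightOneSpectrum (𝓞 K))) (hL : L ⊆ (W.shapiroTower K p κ).degreeTwoPrimes p) (hLS : ∀ v ∈ L, v ∉ S)
  {m : ℕ} (hm : 1 ≤ m)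

/-- **Howard's Lemma 2.2.7 in the `Hom.cond_le` currency for lit's source `S_Λ`**: for `k ≤ j+1`, `(ω_{j+1}, p^{j+1}) ≤ (q_m, p^k)`,
the same `S ⊇ {v ∣ p}` and the (N1) local torsion bound at `S ∖ {p}`, the local `H¹` of the level map `shapiroToEisensteinLevelMap (j+1) k`
(any equivariance proof) carries `(shapiroTowerTriple … j).cond v` into Howard's `F_𝔮` at level `k` (D1's `eisensteinSelmerStructure`,
SAME `S`, ordinary data `ordinaryFiltrationAt`) at every place `v`.
[cite: Howard2004HeegnerKolyvagin, Lemma 2.2.7, Rem. 1.2.4 and proof of Thm. 2.2.10 (arXiv p. 7 L13–27, p0016 L142–148, p0017 L78–81)] [cite: CastellaGrossiLeeSkinner2022, §3.4] -/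
theorem map_shapiroTowerTriple_cond_le_eisensteinSelmerStructure (j k : ℕ) (hσ : k ≤ j + 1)
    (hle : shapiroIdeal p (j + 1) ≤ Ideal.span {(PowerSeries.X ^ m + PowerSeries.C (p : ℤ_[p]) : IwasawaAlgebra p)} ⊔
      Ideal.span {PowerSeries.C ((p : ℤ_[p]) ^ k)})
    (hS : ∀ v ∈ S, ((p : ℕ) : 𝓞 K) ∉ v.asIdeal → ∃ c : ℕ, ∀ i, 1 ≤ i → ∀ x : galoisCohomology
      ((κ.eisensteinTwist ((W.baseChange K).torsionGaloisModule ((p : ℤ) ^ i)) hm i).toLocal (Sum.inr v)) 1, p ^ c • x = 0)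
    (v : NumberField.Place K)
    (h : ∀ (g : absoluteGaloisGroup (NumberField.Place.Completion v)) (x : W.ShapiroLevel K p j),
      κ.shapiroToEisensteinLevelMap (W.baseChange K) hm (j + 1) k hσ hle (((W.shapiroTower K p κ).ρ j).toLocal v g x) =
        (((κ.eisensteinTwist ((W.baseChange K).torsionGaloisModule ((p : ℤ) ^ k)) hm k :
          ContinuousRep (absoluteGaloisGroup K) ℤ
            (EisensteinLevel p m (fun j ↦ geomTorsion (W.baseChange K) ((p : ℤ) ^ j)) k))).toLocal v) g
          (κ.shapiroToEisensteinLevelMap (W.baseChange K) hm (j + 1) k hσ hle x)) :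
    ((W.shapiroTowerTriple κ S hpS hbad L hL hLS j).cond v).map
      (ContinuousRep.cohomologyMap (((W.shapiroTower K p κ).ρ j).toLocal v)
        (((κ.eisensteinTwist ((W.baseChange K).torsionGaloisModule ((p : ℤ) ^ k)) hm k :
          ContinuousRep (absoluteGaloisGroup K) ℤ
            (EisensteinLevel p m (fun j ↦ geomTorsion (W.baseChange K) ((p : ℤ) ^ j)) k))).toLocal v)
        (κ.shapiroToEisensteinLevelMap (W.baseChange K) hm (j + 1) k hσ hle) continuous_of_discreteTopology h 1) ≤
      κ.eisensteinSelmerStructure (fun j ↦ (W.baseChange K).torsionGaloisModule ((p : ℤ) ^ j)) (fun j ↦ (W.baseChange K).torsionGaloisModuleReduce p j) hm S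
        (fun v _ ↦ (W.baseChange K).ordinaryFiltrationAt v (fun k ↦ (W.baseChange K).torsionGaloisModuleReduce p k)
          (fun _ _ ↦ rfl)) k v := by
  rw [κ.cohomologyMap_toLocal_shapiroToEisensteinLevelMap_succ_eq (fun j ↦ (W.baseChange K).torsionGaloisModuleReduce p j)
    (fun j ↦ (W.baseChange K).torsionGaloisModuleReduce_surjective p j) hm v j k hσ hle h]
  exact κ.map_coeffSelmerStructure_succ_le_eisensteinSelmerStructure (fun j ↦ (W.baseChange K).torsionGaloisModuleReduce p j) (fun _ _ ↦ rfl)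
    (fun j ↦ (W.baseChange K).torsionGaloisModuleReduce_surjective p j) hm S
    (fun v _ ↦ (W.baseChange K).ordinaryFiltrationAt v (fun k ↦ (W.baseChange K).torsionGaloisModuleReduce p k)
          (fun _ _ ↦ rfl)) j k hσ hle hS v

section Link

variable {κ} {γ : absoluteGaloisGroup K} (D : (W.baseChange K).LambdaAdicSelmerData κ γ)
  (hγ : κ.IsTopGenerator γ) (hE : ∀ P : (W.baseChange K).toAffine.Point, p • P = 0 → P = 0)

/-- **LINK `H¹(f_{j+1,k}) (Φ′ z)_j = proj_k (toEisensteinH1 z)`**: on lit's `Φ′ = toShapiroSuccLimitH1` (x9-p2's `Φ` read on the shifted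
tower at the twist `κ.unitTwist (-1)`), the functorial `H¹` of the carriers-level map `f_{j+1,k}` at source tower level `j` is the
`k`-th projection of D1's compact control map — C8's hook, one index up.
[cite: Howard2004HeegnerKolyvagin, proof of Thm. 2.2.10 (arXiv p0017 L78–81)] [cite: CastellaGrossiLeeSkinner2022, Rem. 4.1.4] -/
theorem map_shapiroToEisensteinTwistLe_toShapiroSuccLimitH1_eq_proj_toEisensteinH1
    (I : ZpExtension.EisensteinH1Data (κ.unitTwist (-1)) (fun k ↦ (W.baseChange K).torsionGaloisModule ((p : ℤ) ^ k))
      (fun j ↦ (W.baseChange K).torsionGaloisModuleReduce p j) hm)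
    (j k : ℕ) (hσ : k ≤ j + 1)
    (hle : shapiroIdeal p (j + 1) ≤ Ideal.span {(PowerSeries.X ^ m + PowerSeries.C (p : ℤ_[p]) : IwasawaAlgebra p)} ⊔
      Ideal.span {PowerSeries.C ((p : ℤ_[p]) ^ k)}) (z : D.S) :
    galoisCohomology.map ((κ.unitTwist (-1)).shapiroToEisensteinTwistLe (W.baseChange K) hm (j + 1) k hσ hle) 1
        ((W.toShapiroSuccLimitH1 D hγ hE z).1 j) =
      I.proj k (D.toEisensteinH1 hm (fun j ↦ (W.baseChange K).torsionGaloisModuleReduce p j) (fun _ _ ↦ rfl) I hγ hE z) :=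
  map_shapiroToEisensteinTwistLe_toShapiroLimitH1_eq_proj_toEisensteinH1 (fun j ↦ (W.baseChange K).torsionGaloisModuleReduce p j) hm D
    (fun _ _ ↦ rfl) (fun j ↦ (W.baseChange K).torsionGaloisModuleReduce_surjective p j) hγ hE I (j + 1) k hσ hle z

end Link

end WeierstrassCurve

end
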